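import Literature.Analysis.FluidPDE.HardSphereEuclideanTransfer
import Literature.Analysis.FluidPDE.HardSphereTorusMeasure
import Literature.Analysis.FluidPDE.HardSphereAlexander
import Literature.Analysis.FluidPDE.HardSphereRegularGeometry
import Literature.Analysis.FluidPDE.LiouvilleBBGKY
import Literature.MathematicalPhysics.KineticTheory.HardSphereEulerProofs

/-!
# Tools on `ℝ³` and the flat torus (helper file of the refutation of `EquilibriumClampedCollisionalWindowLD`, stmt-AtomisticToContinuum-13733; see `Cruxes/EquilibriumClampedCollisionalWindowLD/Disproof.lean` and the evidence WITNESS.md; no Theses declaration is asserted positively; refuter-cdisprove-stmt-AtomisticToContinuum-13733-0)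
-/

noncomputable section

open Real
open scoped InnerProductSpace

namespace Summit.AtomisticToContinuum.HydrodynamicLimit.Theorems

namespace EquilibriumClampedCollisionalWindowLDNegative

/-! ## Tools on `ℝ³` and the flat torus `𝕋³` -/

section TorusTools

open Literature.Analysis.FluidPDE Literature.Analysis.FunctionSpaces

/-- Velocity / lifted-position space `ℝ³`. [folklore] -/
abbrev E3 : Type := EuclideanSpace ℝ (Fin 3)

/-- The coordinate unit vectors of `ℝ³`. [folklore] -/
def bv (i : Fin 3) : E3 := EuclideanSpace.single i 1

/-- Coordinate unit vectors have norm one. [folklore] -/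
@[simp] theorem norm_bv (i : Fin 3) : ‖bv i‖ = 1 := by
  simp [bv]

/-- Inner product with a coordinate unit vector is the coordinate. [folklore] -/
@[simp] theorem inner_bv (x : E3) (i : Fin 3) : ⟪x, bv i⟫_ℝ = x i := by
  simp [bv, EuclideanSpace.inner_single_right]

/-- Coordinates of the coordinate unit vectors. [folklore] -/
theorem bv_apply (i j : Fin 3) : bv i j = if j = i then 1 else 0 := by
  simp [bv]

/-- A coordinate is at most the norm. [folklore] -/
theorem abs_apply_le_norm (x : E3) (i : Fin 3) : |x i| ≤ ‖x‖ := by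
  simpa using PiLp.norm_apply_le x i

/-- `proj` is additive (subtraction). [folklore] -/
theorem proj_sub (a b : E3) : Torus.proj (a - b) = Torus.proj a - Torus.proj b := rfl

/-- **The chart identity**: for lifts at distance `< 1/2` the minimal-image separation vector is
the difference of the lifts. [folklore] -/
theorem sepVec_proj_proj {a b : E3} (h : ‖a - b‖ < 1 / 2) :
    (Torus.geometry (Fin 3)).sepVec (Torus.proj a) (Torus.proj b) = a - b := by
  rw [Torus.geometry_sepVec, ← proj_sub, Torus.reprSym_proj_of_norm_lt h]

/-- Torus translation of a projected point is projection of the translated lift. [folklore] -/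
theorem translate_proj (a v : E3) :
    (Torus.geometry (Fin 3)).translate (Torus.proj a) v = Torus.proj (a + v) := by
  rw [Torus.geometry_translate, Torus.proj_add]

/-- A point of the torus is the projection of (reference lift + minimal-image offset). [folklore] -/
theorem eq_proj_add_reprSym (x : UnitAddTorus (Fin 3)) (c : E3) :
    x = Torus.proj (c + Torus.reprSym (x - Torus.proj c)) := by
  rw [Torus.proj_add, Torus.proj_reprSym, add_sub_cancel]

/-- The minimal-image distance to a projected reference point is the norm of the offset. [folklore] -/
theorem euclidDist_proj_eq (x : UnitAddTorus (Fin 3)) (c : E3) :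
    Torus.euclidDist x (Torus.proj c) = ‖Torus.reprSym (x - Torus.proj c)‖ := rfl

/-- A real number whose distance to some integer translate lies in `[δ, 1 - δ]` is at distance
`≥ δ` from every integer. [folklore] -/
theorem le_abs_sub_int {x δ : ℝ} (k₀ : ℤ) (h0 : δ ≤ x - k₀) (h1 : x - k₀ ≤ 1 - δ) (k : ℤ) :
    δ ≤ |x - k| := by
  by_cases hδ : δ ≤ 0
  · exact hδ.trans (abs_nonneg _)
  push Not at hδ
  rcases le_or_gt k k₀ with hk | hk
  · have : (k : ℝ) ≤ k₀ := by exact_mod_cast hk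
    rw [abs_of_nonneg (by linarith)]; linarith
  · have : (k₀ : ℝ) + 1 ≤ k := by exact_mod_cast hk
    rw [abs_of_nonpos (by linarith)]; linarith

/-- **Coordinate lower bound for the minimal-image distance**: if coordinate `i` of `a - b` is at
distance `≥ δ` from every integer, the torus separation of `proj a`, `proj b` is `≥ δ`. [folklore] -/
theorem le_norm_sepVec_of_coord {a b : E3} {i : Fin 3} {δ : ℝ}
    (h : ∀ k : ℤ, δ ≤ |(a i - b i) - k|) :
    δ ≤ ‖(Torus.geometry (Fin 3)).sepVec (Torus.proj a) (Torus.proj b)‖ := by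
  rw [Torus.geometry_sepVec, ← proj_sub]
  refine le_trans ?_ (Torus.abs_reprSym_apply_le_norm _ i)
  rw [Torus.abs_reprSym_apply, Torus.proj_apply, UnitAddCircle.norm_eq]
  have := h (round ((a - b) i))
  simpa using this

/-- Elastic reflection across a contact normal written with the unit normal: if the separation
vector is `-(ε n)` (`‖n‖ = 1`, `ε ≠ 0`) then the pair `(W, η)` becomes `(W - c n, η + c n)` with
`c = ⟪W - η, n⟫`. [folklore] -/
theorem reflectVel_neg_smul_unit {F : Type*} [NormedAddCommGroup F] [InnerProductSpace ℝ F]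
    {n : F} (hn : ‖n‖ = 1) {ε : ℝ} (hε : ε ≠ 0) (W η : F) :
    reflectVel (-(ε • n)) (W, η) = (W - ⟪W - η, n⟫_ℝ • n, η + ⟪W - η, n⟫_ℝ • n) := by
  have hnorm : ‖-(ε • n)‖ ^ 2 = ε ^ 2 := by
    rw [norm_neg, norm_smul, hn, mul_one, Real.norm_eq_abs, sq_abs]
  have hcoef : (⟪W - η, -(ε • n)⟫_ℝ / ‖-(ε • n)‖ ^ 2) • (-(ε • n)) = ⟪W - η, n⟫_ℝ • n := by
    rw [hnorm, inner_neg_right, real_inner_smul_right, smul_neg, smul_smul, ← neg_smul]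
    congr 1
    field_simp
  unfold reflectVel
  simp only
  rw [hcoef]

end TorusTools


end EquilibriumClampedCollisionalWindowLDNegative

end Summit.AtomisticToContinuum.HydrodynamicLimit.Theorems

end
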